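import Literature.AlgebraicTopology.Homotopy.BasepointChange
import Literature.AlgebraicTopology.Homotopy.RelativeHomotopyGroupStructure
import HarnessLib

/-!
# Induced maps on homotopy groups along a propositional base-point equation

Topic `Literature/AlgebraicTopology/Homotopy`. Bookkeeping for based maps: the tree's
`homotopyGroupMap f x : π_N(X, x) → π_N(Y, f x)` and `RelHomotopyGroup.map f hf :
π_N(X, A, a) → π_N(Y, B, f a)` land at the base point `f x`, which for a based self-map
(`f x₀ = x₀` only propositionally, e.g. a reflection of a sphere fixing a point of the equator)
is the wrong type. Following Hatcher, *Algebraic Topology* (2002), §4.1 p. 342 (induced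
homomorphisms of based maps, "basepoint-preserving homotopic maps induce the same homomorphism")
we record the induced maps along an equation `h : y₀ = f x₀`:

* `homotopyGroupMapOfEq f h : π_N(X, x₀) → π_N(Y, y₀)`, `[p] ↦ [f ∘ p]`, equal to
  `homotopyGroupMap` when `h = rfl` (`homotopyGroupMapOfEq_rfl`); multiplicative, functorial,
  a bijection for homeomorphisms;
* **`homotopyGroupMapOfEq_eq_of_homotopy`** — maps joined by a homotopy that is stationary at the
  base point induce the same map (the bending lemma of `BasepointChange.lean` with a constant
  track: `BasepointChange.homotopic_surroundLoop_of_const`, `β_const = id`);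
* `RelHomotopyGroup.mapOfEq f hf hb : π_N(X, A, a) → π_N(Y, B, b)` for a map of pairs and
  `hb : b = f a`, with `mapOfEq_mul`, the naturality `boundary_mapOfEq` (`∂ f_* = (f|A)_* ∂`),
  `mapOfEq_ofAbsolute` (`f_* j = j f_*`), functoriality `mapOfEq_map`, and
  `mapOfEq_eq_default_of_forall_mem` (a relative class whose image lies in `B` is trivial).

Everything is proved; no named facts.

## References

* A. Hatcher, *Algebraic Topology*, CUP (2002), §4.1 pp. 341–344. [HatcherAT2002]
-/

noncomputable section

open Set Function Topology unitInterval
open scoped Topology.Homotopy unitInterval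

namespace Literature.AlgebraicTopology.Homotopy

variable {N : Type*} {X Y Z : Type*} [TopologicalSpace X] [TopologicalSpace Y] [TopologicalSpace Z]

/-! ### `β_γ` for a constant track is the identity -/

namespace BasepointChange

variable [Fintype N]

/-- **`(const a)·q ≃ q` rel `∂Iᴺ`** (the bending lemma with the constant homotopy; Hatcher 2002,
p. 341: `β` of the constant path is the identity). [cite: HatcherAT2002, §4.1 p. 341] -/
theorem homotopic_surroundLoop_refl {a : Z} (q : Ω^ N Z a) :
    GenLoop.Homotopic (surroundLoop (Path.refl a) q) q := by
  let F₀ : C(I × (I^N), Z) := ⟨fun p => q p.2, q.1.continuous.comp continuous_snd⟩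
  have hF₀ : ∀ t, ∀ y ∈ Cube.boundary N, F₀ (t, y) = (ContinuousMap.const I a) t := fun t y hy =>
    GenLoop.boundary q y hy
  have hbend₀ := homotopicRel_bend F₀ (ContinuousMap.const I a) hF₀
  have h00 : F₀.curry 0 = (q : C(I^N, Z)) := by ext y; rfl
  have h01 : (⟨surround (ContinuousMap.const I a) fun y => F₀ (1, y), continuous_surround_curry F₀ _ hF₀⟩ :
      C(I^N, Z)) = (surroundLoop (Path.refl a) q : C(I^N, Z)) := by
    ext y; rfl
  rw [h00, h01] at hbend₀
  exact hbend₀.symm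

/-- **`γ·q ≃ q` for a track `γ` that is constant** (as a function), the end points being equal
propositionally. [cite: HatcherAT2002, §4.1 p. 341] -/
theorem homotopic_surroundLoop_of_const {a b : Z} (e : b = a) (γ : Path a b) (hγ : ∀ t, γ t = a)
    (q : Ω^ N Z b) :
    GenLoop.Homotopic (surroundLoop γ q) ⟨(q : C(I^N, Z)), fun y hy => (q.2 y hy).trans e⟩ := by
  subst e
  have h : surroundLoop γ q = surroundLoop (Path.refl b) q := by
    refine GenLoop.ext _ _ fun y => ?_
    show surround γ q y = surround (Path.refl b) q y
    unfold surround
    split_ifs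
    · rfl
    · exact hγ _
  rw [h]
  exact homotopic_surroundLoop_refl q

/-- **`f ∘ p ≃ γ·(g ∘ p)` rel `∂Iᴺ`** for a homotopy `H : f ≃ g` of maps `X → Y`, a generalized
loop `p` at `x` and the track `γ = H(·, x)` (the tree's `homotopic_genLoopMap_surroundLoop` is the
case of self-maps; same proof: bend `F(t, y) = H(t, p y)`). [cite: Miller2020, Prop. 46.4] -/
theorem homotopic_genLoopMap_surroundLoop' {x : X} {f g : C(X, Y)} (H : f.Homotopy g) (p : Ω^ N X x) :
    GenLoop.Homotopic (genLoopMap f x p) (surroundLoop (H.evalAt x) (genLoopMap g x p)) := by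
  let F : C(I × (I^N), Y) := ⟨fun ty => H (ty.1, p ty.2), H.continuous.comp (continuous_fst.prodMk
    (p.1.continuous.comp continuous_snd))⟩
  have hF : ∀ t, ∀ y ∈ Cube.boundary N, F (t, y) = (H.evalAt x : C(I, Y)) t := fun t y hy => by
    show H (t, p y) = H (t, x)
    rw [GenLoop.boundary p y hy]
  have h := homotopicRel_bend F (H.evalAt x : C(I, Y)) hF
  have h0 : F.curry 0 = (genLoopMap f x p : C(I^N, Y)) := by
    ext y; exact H.apply_zero (p y)
  have h1 : (⟨surround (H.evalAt x : C(I, Y)) fun y => F (1, y), continuous_surround_curry F _ hF⟩ : C(I^N, Y)) =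
      (surroundLoop (H.evalAt x) (genLoopMap g x p) : C(I^N, Y)) := by
    ext y
    show surround (H.evalAt x) (fun y => H (1, p y)) y = surround (H.evalAt x) (genLoopMap g x p) y
    congr 1
    funext y'
    exact H.apply_one (p y')
  rw [h0, h1] at h
  exact h

end BasepointChange

/-! ### Absolute groups -/

section Absolute

variable {x₀ : X} {y₀ : Y} {z₀ : Z}

/-- The generalized loop `f ∘ p` at `y₀`, given `y₀ = f x₀`. [cite: HatcherAT2002, §4.1 p. 342] -/
def genLoopMapOfEq (f : C(X, Y)) (h : y₀ = f x₀) (p : Ω^ N X x₀) : Ω^ N Y y₀ :=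
  ⟨f.comp p.1, fun y hy => by rw [ContinuousMap.comp_apply, h]; exact congrArg f (p.2 y hy)⟩

/-- `genLoopMapOfEq f h p` is `f ∘ p` pointwise. [folklore] -/
@[simp]
theorem genLoopMapOfEq_apply (f : C(X, Y)) (h : y₀ = f x₀) (p : Ω^ N X x₀) (y : I^N) :
    genLoopMapOfEq f h p y = f (p y) := rfl

/-- **The induced map `f_* : π_N(X, x₀) → π_N(Y, y₀)` along `y₀ = f x₀`.**
[cite: HatcherAT2002, §4.1 p. 342] -/
def homotopyGroupMapOfEq (f : C(X, Y)) (h : y₀ = f x₀) : HomotopyGroup N X x₀ → HomotopyGroup N Y y₀ :=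
  Quotient.map (genLoopMapOfEq f h) fun _ _ hpq => ContinuousMap.HomotopicRel.comp_continuousMap hpq f

/-- `f_* [p] = [f ∘ p]`. [folklore] -/
@[simp]
theorem homotopyGroupMapOfEq_mk (f : C(X, Y)) (h : y₀ = f x₀) (p : Ω^ N X x₀) :
    homotopyGroupMapOfEq f h (⟦p⟧ : HomotopyGroup N X x₀) = ⟦genLoopMapOfEq f h p⟧ := rfl

/-- For `h = rfl` this is the tree's `homotopyGroupMap`. [folklore] -/
theorem homotopyGroupMapOfEq_rfl (f : C(X, Y)) (x₀ : X) :
    homotopyGroupMapOfEq (N := N) f (rfl : f x₀ = f x₀) = homotopyGroupMap f x₀ := by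
  funext c
  induction c using Quotient.inductionOn with
  | h p => rfl

/-- `f_*` preserves the class of the constant loop. [folklore] -/
theorem homotopyGroupMapOfEq_const (f : C(X, Y)) (h : y₀ = f x₀) :
    homotopyGroupMapOfEq f h (⟦GenLoop.const⟧ : HomotopyGroup N X x₀) = ⟦GenLoop.const⟧ := by
  subst h
  exact congrArg (Quotient.mk _) (GenLoop.ext _ _ fun _ => rfl)

/-- `f_*` is multiplicative (`|N| ≥ 1`). [cite: HatcherAT2002, §4.1 p. 342] -/
theorem homotopyGroupMapOfEq_mul [DecidableEq N] [Nonempty N] (f : C(X, Y)) (h : y₀ = f x₀)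
    (a b : HomotopyGroup N X x₀) :
    homotopyGroupMapOfEq f h (a * b) = homotopyGroupMapOfEq f h a * homotopyGroupMapOfEq f h b := by
  subst h
  rw [homotopyGroupMapOfEq_rfl]
  exact homotopyGroupMap_mul f x₀ a b

/-- `f_*` as a group homomorphism (`|N| ≥ 1`). [cite: HatcherAT2002, §4.1 p. 342] -/
def homotopyGroupMapOfEqHom [DecidableEq N] [Nonempty N] (f : C(X, Y)) (h : y₀ = f x₀) :
    HomotopyGroup N X x₀ →* HomotopyGroup N Y y₀ :=
  MonoidHom.mk' (homotopyGroupMapOfEq f h) (homotopyGroupMapOfEq_mul f h)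

/-- `homotopyGroupMapOfEqHom` as a function. [folklore] -/
@[simp]
theorem coe_homotopyGroupMapOfEqHom [DecidableEq N] [Nonempty N] (f : C(X, Y)) (h : y₀ = f x₀) :
    ⇑(homotopyGroupMapOfEqHom (N := N) f h) = homotopyGroupMapOfEq f h := rfl

/-- `f_*` commutes with inverses (`|N| ≥ 1`). [folklore] -/
theorem homotopyGroupMapOfEq_inv [DecidableEq N] [Nonempty N] (f : C(X, Y)) (h : y₀ = f x₀)
    (a : HomotopyGroup N X x₀) : homotopyGroupMapOfEq f h a⁻¹ = (homotopyGroupMapOfEq f h a)⁻¹ :=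
  map_inv (homotopyGroupMapOfEqHom (N := N) f h) a

/-- **Functoriality**: `g_* (f_* c) = (g ∘ f)_* c`. [cite: HatcherAT2002, §4.1 p. 342] -/
theorem homotopyGroupMapOfEq_comp (g : C(Y, Z)) (hg : z₀ = g y₀) (f : C(X, Y)) (hf : y₀ = f x₀)
    (c : HomotopyGroup N X x₀) :
    homotopyGroupMapOfEq g hg (homotopyGroupMapOfEq f hf c) =
      homotopyGroupMapOfEq (g.comp f) (hg.trans (congrArg g hf)) c := by
  induction c using Quotient.inductionOn with
  | h p => exact congrArg (Quotient.mk _) (GenLoop.ext _ _ fun _ => rfl)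

/-- The identity induces the identity. [folklore] -/
theorem homotopyGroupMapOfEq_id (h : x₀ = x₀) (c : HomotopyGroup N X x₀) :
    homotopyGroupMapOfEq (ContinuousMap.id X) h c = c := by
  induction c using Quotient.inductionOn with
  | h p => exact congrArg (Quotient.mk _) (GenLoop.ext _ _ fun _ => rfl)

/-- Equal maps induce equal maps. [folklore] -/
theorem homotopyGroupMapOfEq_congr {f g : C(X, Y)} (hfg : f = g) (hf : y₀ = f x₀) (hg : y₀ = g x₀)
    (c : HomotopyGroup N X x₀) : homotopyGroupMapOfEq f hf c = homotopyGroupMapOfEq g hg c := by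
  subst hfg; rfl

/-- A homeomorphism induces a bijection. [folklore] -/
theorem bijective_homotopyGroupMapOfEq_homeomorph (e : X ≃ₜ Y) (h : y₀ = e x₀) :
    Bijective (homotopyGroupMapOfEq (N := N) (e : C(X, Y)) h) := by
  subst h
  rw [homotopyGroupMapOfEq_rfl]
  exact bijective_homotopyGroupMap_homeomorph e x₀

/-- **Based-homotopic maps induce the same map** (Hatcher 2002, p. 342: "if `φₜ : (X, x₀) →
(Y, y₀)` is a basepoint-preserving homotopy then `φ₀_* = φ₁_*`"; here from the free bending lemma
with a constant track). [cite: HatcherAT2002, §4.1 p. 342] -/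
theorem homotopyGroupMapOfEq_eq_of_homotopy [Fintype N] {f g : C(X, Y)} (H : f.Homotopy g)
    (hf : y₀ = f x₀) (hg : y₀ = g x₀) (hH : ∀ t, H (t, x₀) = y₀) (c : HomotopyGroup N X x₀) :
    homotopyGroupMapOfEq f hf c = homotopyGroupMapOfEq g hg c := by
  subst hf
  induction c using Quotient.inductionOn with
  | h p =>
    refine Quotient.sound ?_
    have h1 := BasepointChange.homotopic_genLoopMap_surroundLoop' H p
    have h2 := BasepointChange.homotopic_surroundLoop_of_const (N := N) hg.symm (H.evalAt x₀) hH
      (genLoopMap g x₀ p)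
    exact h1.trans h2

end Absolute

/-! ### Relative groups -/

namespace RelHomotopyGroup

variable {i : N} {A : Set X} {B : Set Y} {C : Set Z} {a : A} {b : B} {c₀ : C}

/-- The relative loop `f ∘ p` at `b`, given `b = f a` (map of pairs `(X, A) → (Y, B)`).
[cite: HatcherAT2002, §4.1 p. 344] -/
def _root_.Literature.AlgebraicTopology.Homotopy.RelGenLoop.mapOfEq (f : C(X, Y)) (hf : MapsTo f A B)
    (hb : (b : Y) = f a) (p : RelGenLoop i A a) : RelGenLoop i B b :=
  ⟨f.comp p.1, fun y hy => hf (RelGenLoop.apply_mem p hy), fun y hy => by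
    show f (p y) = b
    rw [RelGenLoop.apply_of_mem_jBoundary p hy, hb]⟩

/-- `mapOfEq f hf hb p` is `f ∘ p` pointwise. [folklore] -/
@[simp]
theorem _root_.Literature.AlgebraicTopology.Homotopy.RelGenLoop.mapOfEq_apply (f : C(X, Y))
    (hf : MapsTo f A B) (hb : (b : Y) = f a) (p : RelGenLoop i A a) (y : I^N) :
    RelGenLoop.mapOfEq f hf hb p y = f (p y) := rfl

/-- **The induced map `f_* : π_N(X, A, a) → π_N(Y, B, b)` of a map of pairs along `b = f a`.**
[cite: HatcherAT2002, §4.1 p. 344] -/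
def mapOfEq (f : C(X, Y)) (hf : MapsTo f A B) (hb : (b : Y) = f a) :
    RelHomotopyGroup i X A a → RelHomotopyGroup i Y B b :=
  Quotient.map (RelGenLoop.mapOfEq f hf hb) fun p q h => by
    obtain ⟨H⟩ := h
    refine ⟨{ toFun := fun ty => f (H ty)
              continuous_toFun := f.continuous.comp H.continuous
              map_zero_left := fun y => by show f (H (0, y)) = f (p y); rw [H.apply_zero]; rfl
              map_one_left := fun y => by show f (H (1, y)) = f (q y); rw [H.apply_one]; rfl
              prop' := fun t => ⟨fun y hy => hf ((H.prop' t).1 y hy), fun y hy => ?_⟩ }⟩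
    show f (H (t, y)) = b
    rw [hb]
    exact congrArg f ((H.prop' t).2 y hy)

/-- `f_* [p] = [f ∘ p]`. [folklore] -/
@[simp]
theorem mapOfEq_mk (f : C(X, Y)) (hf : MapsTo f A B) (hb : (b : Y) = f a) (p : RelGenLoop i A a) :
    mapOfEq f hf hb (⟦p⟧ : RelHomotopyGroup i X A a) = ⟦RelGenLoop.mapOfEq f hf hb p⟧ := rfl

/-- For `b = ⟨f a, _⟩` this is the tree's `RelHomotopyGroup.map`. [folklore] -/
theorem mapOfEq_rfl (f : C(X, Y)) (hf : MapsTo f A B) :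
    mapOfEq (i := i) (a := a) (b := ⟨f a, hf a.2⟩) f hf rfl = map f hf := by
  funext c
  induction c using Quotient.inductionOn with
  | h p => rfl

/-- `f_*` preserves base points. [folklore] -/
@[simp]
theorem mapOfEq_default (f : C(X, Y)) (hf : MapsTo f A B) (hb : (b : Y) = f a) :
    mapOfEq f hf hb (default : RelHomotopyGroup i X A a) = default :=
  congrArg (Quotient.mk _) (RelGenLoop.ext _ _ fun _ => hb.symm ▸ rfl)

/-- `f_*` is multiplicative (`|N| ≥ 2`). [cite: HatcherAT2002, §4.1 p. 344] -/
theorem mapOfEq_mul [DecidableEq N] [Nonempty { j // j ≠ i }] (f : C(X, Y)) (hf : MapsTo f A B)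
    (hb : (b : Y) = f a) (c d : RelHomotopyGroup i X A a) :
    mapOfEq f hf hb (c * d) = mapOfEq f hf hb c * mapOfEq f hf hb d := by
  obtain ⟨b, hbB⟩ := b
  simp only at hb
  subst hb
  rw [mapOfEq_rfl]
  exact map_mul f hf c d

/-- `f_*` as a group homomorphism (`|N| ≥ 2`). [cite: HatcherAT2002, §4.1 p. 344] -/
def mapOfEqHom [DecidableEq N] [Nonempty { j // j ≠ i }] (f : C(X, Y)) (hf : MapsTo f A B)
    (hb : (b : Y) = f a) : RelHomotopyGroup i X A a →* RelHomotopyGroup i Y B b :=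
  { toFun := mapOfEq f hf hb
    map_one' := by rw [one_eq_default, mapOfEq_default, one_eq_default]
    map_mul' := mapOfEq_mul f hf hb }

/-- `mapOfEqHom` as a function. [folklore] -/
@[simp]
theorem coe_mapOfEqHom [DecidableEq N] [Nonempty { j // j ≠ i }] (f : C(X, Y)) (hf : MapsTo f A B)
    (hb : (b : Y) = f a) : ⇑(mapOfEqHom (i := i) f hf hb) = mapOfEq f hf hb := rfl

/-- `f_*` commutes with inverses (`|N| ≥ 2`). [folklore] -/
theorem mapOfEq_inv [DecidableEq N] [Nonempty { j // j ≠ i }] (f : C(X, Y)) (hf : MapsTo f A B)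
    (hb : (b : Y) = f a) (c : RelHomotopyGroup i X A a) : mapOfEq f hf hb c⁻¹ = (mapOfEq f hf hb c)⁻¹ :=
  map_inv (mapOfEqHom (i := i) f hf hb) c

/-- **Naturality of `∂`**: `∂ (f_* c) = (f|A)_* (∂ c)`, for any continuous `f' : A → B`
agreeing with `f`. [cite: HatcherAT2002, §4.1 p. 344] -/
theorem boundary_mapOfEq [DecidableEq N] (f : C(X, Y)) (hf : MapsTo f A B) (hb : (b : Y) = f a)
    (f' : C(A, B)) (hf' : ∀ x, (f' x : Y) = f x) (c : RelHomotopyGroup i X A a) :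
    boundary (mapOfEq f hf hb c) =
      homotopyGroupMapOfEq f' (Subtype.ext (hb.trans (hf' a).symm)) (boundary c) := by
  induction c using Quotient.inductionOn with
  | h p => exact congrArg (Quotient.mk _) (GenLoop.ext _ _ fun y' => Subtype.ext (hf' (RelGenLoop.face p y')).symm)

/-- **Naturality of `j`**: `f_* (j c) = j (f_* c)`. [cite: HatcherAT2002, §4.1 p. 344] -/
theorem mapOfEq_ofAbsolute (f : C(X, Y)) (hf : MapsTo f A B) (hb : (b : Y) = f a)
    (c : HomotopyGroup N X (a : X)) :
    mapOfEq f hf hb (ofAbsolute i c) = ofAbsolute i (homotopyGroupMapOfEq f hb c) := by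
  induction c using Quotient.inductionOn with
  | h p => rfl

/-- **Functoriality**: `g_* (f_* c) = (g ∘ f)_* c` for maps of pairs. [cite: HatcherAT2002, §4.1 p. 344] -/
theorem mapOfEq_mapOfEq (g : C(Y, Z)) (hg : MapsTo g B C) (hc : (c₀ : Z) = g b) (f : C(X, Y))
    (hf : MapsTo f A B) (hb : (b : Y) = f a) (c : RelHomotopyGroup i X A a) :
    mapOfEq g hg hc (mapOfEq f hf hb c) = mapOfEq (g.comp f) (hg.comp hf) (hc.trans (congrArg g hb)) c := by
  induction c using Quotient.inductionOn with
  | h p => rfl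

/-- Functoriality against the tree's `map`: `g_* (map f c) = (g ∘ f)_* c`. [folklore] -/
theorem mapOfEq_map (g : C(Y, Z)) (hg : MapsTo g B C) (f : C(X, Y)) (hf : MapsTo f A B)
    (hc : (c₀ : Z) = g (f a)) (c : RelHomotopyGroup i X A a) :
    mapOfEq g hg hc (map f hf c) = mapOfEq (g.comp f) (hg.comp hf) hc c := by
  induction c using Quotient.inductionOn with
  | h p => rfl

/-- Equal maps of pairs induce equal maps. [folklore] -/
theorem mapOfEq_congr {f g : C(X, Y)} (hfg : f = g) (hf : MapsTo f A B) (hg : MapsTo g A B)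
    (hb : (b : Y) = f a) (hb' : (b : Y) = g a) (c : RelHomotopyGroup i X A a) :
    mapOfEq f hf hb c = mapOfEq g hg hb' c := by
  subst hfg; rfl

/-- **A relative class whose image lies in `B` is trivial**: if `f(X) ⊆ B` then `f_* c = 1`
(compression, Hatcher 2002, p. 343). [cite: HatcherAT2002, §4.1 p. 343] -/
theorem mapOfEq_eq_default_of_forall_mem [DecidableEq N] (f : C(X, Y)) (hf : MapsTo f A B)
    (hb : (b : Y) = f a) (hfB : ∀ x, f x ∈ B) (c : RelHomotopyGroup i X A a) :
    mapOfEq f hf hb c = default := by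
  induction c using Quotient.inductionOn with
  | h p => exact Quotient.sound (RelGenLoop.homotopic_const_of_forall_mem _ fun y => hfB (p y))

end RelHomotopyGroup

end Literature.AlgebraicTopology.Homotopy

end
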